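import Mathlib
import Literature.Computability.AlgebraicComplexity.SchonhageStrassen
import HarnessLib

/-!
# Schönhage–Strassen on coefficient vectors: the recursive algorithm and its correctness

Topic `Computability/AlgebraicComplexity`, continuing `FastFourierTransform.lean` and
`SchonhageStrassen.lean`.  There, one level of von zur Gathen–Gerhard's Algorithm 8.20 ("fast
negative wrapped convolution", *Modern Computer Algebra* §8.3) is proved correct at the level
of polynomials, the multiplications in `D = R[x]/(x^{2m}+1)` being left abstract.  Here the
algorithm is spelled out as a **recursive function on coefficient vectors** `ℕ → R` — the form
in which a machine executes it — and proved correct as a whole (GG Thm 8.22, correctness):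

* `nshift1 d`, `nshift d s` — multiplication by `x`, `x^s` in `R[x]/(x^d+1)` on coefficient
  vectors (cyclic shift with a sign); `evalD d v = (∑_{l<d} v_l x^l) mod (x^d+1) ∈ AdjoinRoot`
  and the homomorphism lemmas `evalD_add/sub/smul/nshift`;
* `fftVec d k e A` — the FFT of `FastFourierTransform.fft` on vectors representing elements of
  `D`, twiddle factors `ω^l = x^{el}` realised by shifts (`evalD_fftVec`);
* `fastNconvVec` — `fastNconv` on vectors, with the products in `D` supplied as a parameter
  (`evalD_fastNconvVec`);
* `blockVec`, `recombine` — steps 2 and 4 of Algorithm 8.20 on vectors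
  (`ofSeq_blockVec`, `recombine_eq_coeff`);
* `negMul half k a b` — **Algorithm 8.20**: for `k ≤ 2` the classical product (`nconv`), else
  `m = 2^{⌊k/2⌋}`, `t = 2^{⌈k/2⌉}`, blocks of length `m` padded to `2m`, weights/FFTs by shifts,
  `t` recursive products of length `2m = 2^{⌊k/2⌋+1}`, inverse FFT, unweighting, scaling by
  `t⁻¹ = half^{⌈k/2⌉}`, recombination — by well-founded recursion on `k`;
* **`negMul_eq_nconv`**: if `2·half = 1` then `negMul half k a b i = nconv (2^k) a b i` for all
  `i < 2^k`, i.e. the algorithm returns `fg mod (x^{2^k}+1)` (GG Thm 8.22, "Algorithm 8.20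
  works correctly"), by strong induction on `k` from `mul_modByMonic_eq_schonhageStep`.

Operation counts (the `9/2·n log n log log n` of Thm 8.22) are not formalised here.

## References

* J. von zur Gathen, J. Gerhard, *Modern Computer Algebra*, CUP (1st ed. 1999, 3rd ed. 2013),
  §8.3, Algorithm 8.20, Theorem 8.22 (text checked on the internal scan
  panama:448136887664644). [GathenGerhard2013]
* A. Schönhage, V. Strassen, Computing 7 (1971) 281–292. [SchonhageStrassen1971]
-/

namespace Literature.Computability.AlgebraicComplexity

open _root_.Finset _root_.Polynomial

variable {R : Type*} [CommRing R]

/-! ### Linear structure of `ofSeq` -/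

/-- `ofSeq` is additive. [folklore] -/
theorem ofSeq_add (d : ℕ) (u v : ℕ → R) : ofSeq d (u + v) = ofSeq d u + ofSeq d v := by
  simp only [ofSeq, Pi.add_apply, map_add, add_mul, sum_add_distrib]

/-- `ofSeq` commutes with subtraction. [folklore] -/
theorem ofSeq_sub (d : ℕ) (u v : ℕ → R) : ofSeq d (u - v) = ofSeq d u - ofSeq d v := by
  simp only [ofSeq, Pi.sub_apply, map_sub, sub_mul, sum_sub_distrib]

/-- `ofSeq` commutes with scalars. [folklore] -/
theorem ofSeq_smul (d : ℕ) (c : R) (v : ℕ → R) : ofSeq d (c • v) = C c * ofSeq d v := by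
  simp only [ofSeq, Pi.smul_apply, smul_eq_mul, map_mul, mul_assoc, mul_sum]

/-! ### Multiplication by powers of `x` modulo `x^d + 1` on vectors -/

/-- Multiplication by `x` in `R[x]/(x^d+1)` on coefficient vectors of length `d`: shift up by
one, the top coefficient wrapping around with a sign. [cite: GathenGerhard2013, §8.3 (proof of Thm 8.22: "cyclic shift … sign inversion")] -/
def nshift1 (d : ℕ) (v : ℕ → R) : ℕ → R
  | 0 => -v (d - 1)
  | l + 1 => v l

/-- Multiplication by `x^s` in `R[x]/(x^d+1)` on coefficient vectors: `s` single shifts (a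
specification; a machine rotates once). [cite: GathenGerhard2013, §8.3 (proof of Thm 8.22)] -/
def nshift (d s : ℕ) (v : ℕ → R) : ℕ → R := (nshift1 d)^[s] v

/-- `ofSeq d (nshift1 d v) = x · ofSeq d v − v_{d-1} · (x^d + 1)`. [folklore] -/
theorem ofSeq_nshift1 {d : ℕ} (hd : 0 < d) (v : ℕ → R) :
    ofSeq d (nshift1 d v) = X * ofSeq d v - C (v (d - 1)) * (X ^ d + 1) := by
  obtain ⟨d, rfl⟩ : ∃ d', d = d' + 1 := ⟨d - 1, by omega⟩
  simp only [ofSeq, Nat.add_sub_cancel]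
  rw [sum_range_succ', mul_sum, sum_range_succ]
  simp only [nshift1, Nat.add_sub_cancel, pow_zero, mul_one, map_neg]
  have h : ∀ i, X * (C (v i) * X ^ i) = C (v i) * X ^ (i + 1) := fun i => by
    rw [pow_succ]; ring
  simp_rw [h]
  ring

/-- The element of `D = R[x]/(x^d+1)` represented by a coefficient vector. [folklore] -/
noncomputable def evalD (d : ℕ) (v : ℕ → R) : AdjoinRoot (X ^ d + 1 : R[X]) :=
  AdjoinRoot.mk (X ^ d + 1) (ofSeq d v)

/-- `evalD` is additive. [folklore] -/
theorem evalD_add (d : ℕ) (u v : ℕ → R) : evalD d (u + v) = evalD d u + evalD d v := by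
  unfold evalD; rw [ofSeq_add, map_add]

/-- `evalD` commutes with subtraction. [folklore] -/
theorem evalD_sub (d : ℕ) (u v : ℕ → R) : evalD d (u - v) = evalD d u - evalD d v := by
  unfold evalD; rw [ofSeq_sub, map_sub]

/-- `evalD` turns scalars into constants. [folklore] -/
theorem evalD_smul (d : ℕ) (c : R) (v : ℕ → R) :
    evalD d (c • v) = AdjoinRoot.mk (X ^ d + 1) (C c) * evalD d v := by
  unfold evalD; rw [ofSeq_smul, map_mul]

/-- **`nshift1` is multiplication by the root `x`.** [folklore] -/
theorem evalD_nshift1 {d : ℕ} (hd : 0 < d) (v : ℕ → R) :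
    evalD d (nshift1 d v) = AdjoinRoot.root (X ^ d + 1) * evalD d v := by
  unfold evalD
  rw [ofSeq_nshift1 hd, map_sub, map_mul, map_mul, AdjoinRoot.mk_self, mul_zero, sub_zero,
    AdjoinRoot.mk_X]

/-- **`nshift d s` is multiplication by `x^s`.** [folklore] -/
theorem evalD_nshift {d : ℕ} (hd : 0 < d) (v : ℕ → R) :
    ∀ s, evalD d (nshift d s v) = AdjoinRoot.root (X ^ d + 1) ^ s * evalD d v
  | 0 => by simp [nshift]
  | s + 1 => by
    rw [nshift, Function.iterate_succ_apply', ← nshift, evalD_nshift1 hd, evalD_nshift hd v s,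
      pow_succ]; ring

/-! ### The FFT and the fast negacyclic convolution on vectors -/

/-- The FFT `fft` of `FastFourierTransform.lean` on vectors representing elements of
`D = R[x]/(x^d+1)`, for `ω = x^e`: the twiddle factor `ω^l` is the shift `nshift d (e·l)`, the
recursion uses `ω² = x^{2e}`. [cite: GathenGerhard2013, §8.2 Algorithm 8.14 / §8.3] -/
def fftVec (d : ℕ) : ℕ → ℕ → (ℕ → ℕ → R) → ℕ → ℕ → R
  | 0, _, A, _ => A 0
  | k + 1, e, A, j =>
      if j % 2 = 0 then fftVec d k (2 * e) (fun l => A l + A (2 ^ k + l)) (j / 2)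
      else fftVec d k (2 * e) (fun l => nshift d (e * l) (A l - A (2 ^ k + l))) (j / 2)

/-- **`fftVec` represents `fft`.** [folklore] -/
theorem evalD_fftVec {d : ℕ} (hd : 0 < d) : ∀ (k e : ℕ) (A : ℕ → ℕ → R) (j : ℕ),
    evalD d (fftVec d k e A j) =
      fft k (AdjoinRoot.root (X ^ d + 1) ^ e) (fun i => evalD d (A i)) j
  | 0, e, A, j => by simp [fftVec, fft]
  | k + 1, e, A, j => by
    have hsq : AdjoinRoot.root (X ^ d + 1 : R[X]) ^ e * AdjoinRoot.root (X ^ d + 1) ^ e =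
        AdjoinRoot.root (X ^ d + 1) ^ (2 * e) := by rw [← pow_add, two_mul]
    rw [fftVec, fft]
    split_ifs with hj
    · have hfun : (fun i => evalD d (A i + A (2 ^ k + i))) =
          fun l => evalD d (A l) + evalD d (A (2 ^ k + l)) := by
        funext i; rw [evalD_add]
      rw [evalD_fftVec hd k, hsq, hfun]
    · have hfun : (fun i => evalD d (nshift d (e * i) (A i - A (2 ^ k + i)))) =
          fun l => (evalD d (A l) - evalD d (A (2 ^ k + l))) *
            (AdjoinRoot.root (X ^ d + 1) ^ e) ^ l := by
        funext i; rw [evalD_nshift hd, evalD_sub, ← pow_mul]; ring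
      rw [evalD_fftVec hd k, hsq, hfun]

/-- `fastNconv` of `FastFourierTransform.lean` on vectors (weights `η^i = x^{ηe·i}`, three FFTs
with `ω = x^{2ηe}`, pointwise products `mulD` in `D`, unweighting, scaling by `c = t⁻¹`).
[cite: GathenGerhard2013, §8.3 Algorithm 8.20 step 3] -/
def fastNconvVec (d κ ηe : ℕ) (c : R) (mulD : (ℕ → R) → (ℕ → R) → ℕ → R)
    (A B : ℕ → ℕ → R) (k : ℕ) : ℕ → R :=
  c • nshift d (ηe * (2 * 2 ^ κ - k))
    (fftVec d κ (2 * ηe)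
      (fun l => mulD (fftVec d κ (2 * ηe) (fun i => nshift d (ηe * i) (A i)) l)
        (fftVec d κ (2 * ηe) (fun i => nshift d (ηe * i) (B i)) l))
      ((2 ^ κ - k) % 2 ^ κ))

/-- **`fastNconvVec` represents `fastNconv`**, provided `mulD` represents multiplication in
`D`. [folklore] -/
theorem evalD_fastNconvVec {d : ℕ} (hd : 0 < d) (κ ηe : ℕ) (c : R)
    {mulD : (ℕ → R) → (ℕ → R) → ℕ → R}
    (hmul : ∀ u v, evalD d (mulD u v) = evalD d u * evalD d v) (A B : ℕ → ℕ → R) (k : ℕ) :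
    evalD d (fastNconvVec d κ ηe c mulD A B k) =
      fastNconv κ (AdjoinRoot.root (X ^ d + 1) ^ ηe) (AdjoinRoot.mk (X ^ d + 1) (C c))
        (fun i => evalD d (A i)) (fun i => evalD d (B i)) k := by
  have hsq : AdjoinRoot.root (X ^ d + 1 : R[X]) ^ ηe * AdjoinRoot.root (X ^ d + 1) ^ ηe =
      AdjoinRoot.root (X ^ d + 1) ^ (2 * ηe) := by rw [← pow_add, two_mul]
  have hw : ∀ X' : ℕ → ℕ → R, (fun i => evalD d (nshift d (ηe * i) (X' i))) =
      fun i => (AdjoinRoot.root (X ^ d + 1) ^ ηe) ^ i * evalD d (X' i) := by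
    intro X'; funext i; rw [evalD_nshift hd, pow_mul]
  have hfun : (fun i => evalD d (mulD
      (fftVec d κ (2 * ηe) (fun i => nshift d (ηe * i) (A i)) i)
      (fftVec d κ (2 * ηe) (fun i => nshift d (ηe * i) (B i)) i))) =
      fun l => fft κ (AdjoinRoot.root (X ^ d + 1) ^ (2 * ηe))
          (fun i => (AdjoinRoot.root (X ^ d + 1) ^ ηe) ^ i * evalD d (A i)) l *
        fft κ (AdjoinRoot.root (X ^ d + 1) ^ (2 * ηe))
          (fun i => (AdjoinRoot.root (X ^ d + 1) ^ ηe) ^ i * evalD d (B i)) l := by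
    funext l
    rw [hmul, evalD_fftVec hd, evalD_fftVec hd, hw, hw]
  rw [fastNconvVec, fastNconv, evalD_smul, evalD_nshift hd, evalD_fftVec hd, hsq, ← pow_mul,
    mul_assoc, hfun]

/-! ### Blocks and recombination on vectors -/

/-- Block `i` of length `m` of a vector of length `n`, zero-padded (step 2 of Algorithm 8.20).
[cite: GathenGerhard2013, §8.3 Algorithm 8.20 step 2] -/
def blockVec (n m : ℕ) (a : ℕ → R) (i : ℕ) : ℕ → R :=
  fun l => if l < m ∧ m * i + l < n then a (m * i + l) else 0

/-- `blockVec` represents `block` of the represented polynomial. [folklore] -/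
theorem ofSeq_blockVec {n m d : ℕ} (hmd : m ≤ d) (a : ℕ → R) (i : ℕ) :
    ofSeq d (blockVec n m a i) = block m (ofSeq n a) i := by
  ext l
  simp only [coeff_ofSeq, coeff_block, blockVec]
  split_ifs <;> first | rfl | (exfalso; omega)

/-- Truncation of a vector to length `d`. [folklore] -/
def trunc (d : ℕ) (v : ℕ → R) : ℕ → R := fun l => if l < d then v l else 0

/-- Step 4 of Algorithm 8.20 on vectors: coefficient `i` of `(∑_{k<t} h_k x^{mk}) mod (x^n+1)`
for `h_k` given by vectors of length `d` (overlap-add of the blocks, the part above degree `n`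
wrapped around with a sign). [cite: GathenGerhard2013, §8.3 Algorithm 8.20 step 4] -/
def recombine (n m t d : ℕ) (hv : ℕ → ℕ → R) (i : ℕ) : R :=
  (∑ k ∈ range t, if m * k ≤ i then trunc d (hv k) (i - m * k) else 0) -
    ∑ k ∈ range t, if m * k ≤ i + n then trunc d (hv k) (i + n - m * k) else 0

/-- Coefficients of `∑_{k<t} ofSeq d (hv k) · x^{mk}`. [folklore] -/
theorem coeff_sum_ofSeq_mul_X_pow (m t d : ℕ) (hv : ℕ → ℕ → R) (e : ℕ) :
    (∑ k ∈ range t, ofSeq d (hv k) * X ^ (m * k)).coeff e =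
      ∑ k ∈ range t, if m * k ≤ e then trunc d (hv k) (e - m * k) else 0 := by
  rw [finsetSum_coeff]
  refine sum_congr rfl fun k _ => ?_
  rw [coeff_mul_X_pow', coeff_ofSeq]
  rfl

/-- **`recombine` is step 4**: for `i < n` and `∑_k ofSeq d (hv k) x^{mk}` of degree `< 2n`,
`recombine n m t d hv i = ((∑_{k<t} ofSeq d (hv k) x^{mk}) mod (x^n+1))_i`. [folklore] -/
theorem recombine_eq_coeff {n m t d : ℕ} (hn : 0 < n) (hv : ℕ → ℕ → R)
    (hdeg : (∑ k ∈ range t, ofSeq d (hv k) * X ^ (m * k)).natDegree < 2 * n) {i : ℕ}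
    (hi : i < n) :
    recombine n m t d hv i =
      ((∑ k ∈ range t, ofSeq d (hv k) * X ^ (m * k)) %ₘ (X ^ n + 1)).coeff i := by
  rw [coeff_modByMonic_X_pow_add_one hn hdeg hi, coeff_sum_ofSeq_mul_X_pow,
    coeff_sum_ofSeq_mul_X_pow, recombine]

/-- Degree of the recombined sum: `deg (∑_{k<t} ofSeq d (hv k) x^{mk}) ≤ d − 1 + m(t−1)`.
[folklore] -/
theorem natDegree_sum_ofSeq_mul_X_pow_le {d : ℕ} (hd : 0 < d) (m t : ℕ) (hv : ℕ → ℕ → R) :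
    (∑ k ∈ range t, ofSeq d (hv k) * X ^ (m * k)).natDegree ≤ d - 1 + m * (t - 1) := by
  refine natDegree_sum_le_of_forall_le _ _ fun k hk => natDegree_mul_le.trans ?_
  have h1 := natDegree_ofSeq_lt hd (hv k)
  have h2 : (X ^ (m * k) : R[X]).natDegree ≤ m * k := natDegree_X_pow_le _
  have h3 : m * k ≤ m * (t - 1) := Nat.mul_le_mul_left m (by have := mem_range.1 hk; omega)
  omega

/-! ### Algorithm 8.20 -/

/-- **GG Algorithm 8.20 (fast negative wrapped convolution) on coefficient vectors.**  Input:
vectors `a, b` of length `2^k` (values beyond are ignored) and `half = 2⁻¹`; output: the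
coefficient vector of `(∑ a_i x^i)(∑ b_i x^i) mod (x^{2^k}+1)` (`negMul_eq_nconv`).  For
`k ≤ 2` the classical formula; otherwise `m = 2^{⌊k/2⌋}`, `t = 2^{k-⌊k/2⌋}`, `d = 2m`,
`η = x^{d/t}`, and the recursion multiplies in `D = R[x]/(x^d+1)` by `negMul` at exponent
`⌊k/2⌋ + 1 < k`. [cite: GathenGerhard2013, §8.3 Algorithm 8.20] -/
noncomputable def negMul (half : R) (k : ℕ) (a b : ℕ → R) : ℕ → R :=
  if hk : k ≤ 2 then nconv (2 ^ k) a b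
  else
    recombine (2 ^ k) (2 ^ (k / 2)) (2 ^ (k - k / 2)) (2 * 2 ^ (k / 2))
      (fastNconvVec (2 * 2 ^ (k / 2)) (k - k / 2) (2 * 2 ^ (k / 2) / 2 ^ (k - k / 2))
        (half ^ (k - k / 2)) (negMul half (k / 2 + 1))
        (blockVec (2 ^ k) (2 ^ (k / 2)) a) (blockVec (2 ^ k) (2 ^ (k / 2)) b))
termination_by k
decreasing_by omega

/-- `ofSeq d` of a vector agreeing below `d` with the coefficients of a polynomial of degree
`< d` is that polynomial. [folklore] -/
theorem ofSeq_eq_of_coeff_eq {d : ℕ} {v : ℕ → R} {p : R[X]} (hp : p.natDegree < d)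
    (h : ∀ l < d, v l = p.coeff l) : ofSeq d v = p := by
  rw [← ofSeq_coeff_eq hp]
  unfold ofSeq
  exact sum_congr rfl fun l hl => by rw [h l (mem_range.1 hl)]

/-- The negacyclic convolution of two vectors is the product of the represented polynomials
modulo `x^n + 1` (coefficientwise, below `n`). [folklore] -/
theorem nconv_eq_coeff_mul_modByMonic {n : ℕ} (hn : 0 < n) (a b : ℕ → R) {i : ℕ} (hi : i < n) :
    nconv n a b i = ((ofSeq n a * ofSeq n b) %ₘ (X ^ n + 1)).coeff i := by
  rw [coeff_mul_modByMonic_eq_nconv hn (natDegree_ofSeq_lt hn a) (natDegree_ofSeq_lt hn b) hi]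
  refine nconv_congr (fun l hl => ?_) (fun l hl => ?_) hi <;> rw [coeff_ofSeq, if_pos hl]

/-- A vector multiplication that is correct below `d` represents multiplication in `D`.
[folklore] -/
theorem evalD_mul_of_eq_nconv {d : ℕ} (hd : 0 < d) {mulD : (ℕ → R) → (ℕ → R) → ℕ → R}
    (h : ∀ u v, ∀ l < d, mulD u v l = nconv d u v l) (u v : ℕ → R) :
    evalD d (mulD u v) = evalD d u * evalD d v := by
  have hmon : (X ^ d + 1 : R[X]).Monic := monic_X_pow_add_one hd
  have key : ofSeq d (mulD u v) = (ofSeq d u * ofSeq d v) %ₘ (X ^ d + 1) := by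
    nontriviality R
    refine ofSeq_eq_of_coeff_eq ?_ fun l hl => ?_
    · have h1 : (X ^ d + 1 : R[X]) ≠ 1 := by
        intro h1
        have := congrArg natDegree h1
        rw [natDegree_X_pow_add_one, natDegree_one] at this
        omega
      have := natDegree_modByMonic_lt (ofSeq d u * ofSeq d v) hmon h1
      rwa [natDegree_X_pow_add_one] at this
    · rw [h u v l hl, nconv_eq_coeff_mul_modByMonic hd u v hl]
  rw [evalD, key, evalD, evalD, ← map_mul]
  exact AdjoinRoot.mk_eq_mk.2 (dvd_modByMonic_sub _ _)

/-- **GG Theorem 8.22 (correctness): Algorithm 8.20 works correctly.**  If `2·half = 1` in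
`R` then for every `k` and all vectors `a, b`, `negMul half k a b i = nconv (2^k) a b i` for
`i < 2^k` — the algorithm returns the negative wrapped convolution, i.e. the coefficients of
`(∑_{i<2^k} a_i x^i)(∑_{i<2^k} b_i x^i) mod (x^{2^k}+1)` (`nconv_eq_coeff_mul_modByMonic`).
Proof: strong induction on `k`; the step is `mul_modByMonic_eq_schonhageStep` transported to
vectors by `evalD_fastNconvVec`, `ofSeq_blockVec`, `recombine_eq_coeff`, the recursive
products being correct by induction (`evalD_mul_of_eq_nconv`). [cite: GathenGerhard2013, §8.3 Thm 8.22] -/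
theorem negMul_eq_nconv {half : R} (hhalf : 2 * half = 1) :
    ∀ (k : ℕ) (a b : ℕ → R), ∀ i < 2 ^ k, negMul half k a b i = nconv (2 ^ k) a b i := by
  intro k
  induction k using Nat.strong_induction_on with
  | _ k ih =>
  intro a b i hi
  rw [negMul]
  split_ifs with hk
  · rfl
  -- parameters: `q = ⌊k/2⌋`, `m = 2^q`, `t = 2^(k-q)`, `d = 2m = 2^(q+1)`
  set q := k / 2 with hq
  have hκ : k - q ≤ q + 1 := by omega
  have hlt : q + 1 < k := by omega
  set m : ℕ := 2 ^ q with hm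
  have hm0 : 0 < m := by positivity
  have ht0 : 0 < 2 ^ (k - q) := by positivity
  have hd : 2 * m = 2 ^ (q + 1) := by rw [hm, pow_succ, mul_comm]
  have hd0 : 0 < 2 * m := by omega
  have hn : 2 ^ k = m * 2 ^ (k - q) := by
    rw [hm, ← pow_add, Nat.add_sub_cancel' (by omega : q ≤ k)]
  have hdvd : 2 ^ (k - q) ∣ 2 * m := by
    rw [hd]; exact Nat.pow_dvd_pow 2 hκ
  have hn0 : 0 < 2 ^ k := by positivity
  have hmn : m ≤ 2 ^ k := by rw [hn]; exact Nat.le_mul_of_pos_right m ht0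
  -- the recursive products are correct, hence represent multiplication in `D`
  have hmul : ∀ u v, evalD (2 * m) (negMul half (q + 1) u v) =
      evalD (2 * m) u * evalD (2 * m) v := by
    refine evalD_mul_of_eq_nconv hd0 fun u v l hl => ?_
    rw [hd] at hl ⊢
    exact ih (q + 1) hlt u v l hl
  -- right-hand side through polynomials (one level of Algorithm 8.20)
  rw [nconv_eq_coeff_mul_modByMonic hn0 a b hi]
  have hmod : (X ^ 2 ^ k + 1 : R[X]) = X ^ (m * 2 ^ (k - q)) + 1 := by rw [hn]
  have hf : (ofSeq (2 ^ k) a).natDegree < m * 2 ^ (k - q) := hn ▸ natDegree_ofSeq_lt hn0 a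
  have hg : (ofSeq (2 ^ k) b).natDegree < m * 2 ^ (k - q) := hn ▸ natDegree_ofSeq_lt hn0 b
  rw [hmod, mul_modByMonic_eq_schonhageStep hm0 hdvd hhalf hf hg, ← hn]
  -- identify the summands with the vectors computed by the algorithm
  have hη : (AdjoinRoot.mk (X ^ (2 * m) + 1 : R[X])) (X ^ (2 * m / 2 ^ (k - q))) =
      AdjoinRoot.root (X ^ (2 * m) + 1) ^ (2 * m / 2 ^ (k - q)) := by
    rw [map_pow, AdjoinRoot.mk_X]
  have hblk : ∀ c : ℕ → R, (AdjoinRoot.mk (X ^ (2 * m) + 1) ∘ block m (ofSeq (2 ^ k) c)) =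
      fun i => evalD (2 * m) (blockVec (2 ^ k) m c i) := by
    intro c; funext i
    simp only [Function.comp_apply, evalD, ofSeq_blockVec (by omega : m ≤ 2 * m)]
  have hsummand : ∀ j, AdjoinRoot.modByMonicHom (monic_X_pow_add_one hd0)
      (fastNconv (k - q) ((AdjoinRoot.mk (X ^ (2 * m) + 1 : R[X])) (X ^ (2 * m / 2 ^ (k - q))))
        ((AdjoinRoot.mk (X ^ (2 * m) + 1 : R[X])) (C (half ^ (k - q))))
        (AdjoinRoot.mk (X ^ (2 * m) + 1) ∘ block m (ofSeq (2 ^ k) a))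
        (AdjoinRoot.mk (X ^ (2 * m) + 1) ∘ block m (ofSeq (2 ^ k) b)) j) =
      ofSeq (2 * m) (fastNconvVec (2 * m) (k - q) (2 * m / 2 ^ (k - q)) (half ^ (k - q))
        (negMul half (q + 1)) (blockVec (2 ^ k) m a) (blockVec (2 ^ k) m b) j) := by
    intro j
    rw [hη, hblk, hblk, ← evalD_fastNconvVec hd0 (k - q) (2 * m / 2 ^ (k - q)) (half ^ (k - q))
      hmul]
    unfold evalD
    rw [AdjoinRoot.modByMonicHom_mk]
    nontriviality R
    exact (modByMonic_eq_self_iff (monic_X_pow_add_one hd0)).2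
      (degree_lt_degree (by rw [natDegree_X_pow_add_one]; exact natDegree_ofSeq_lt hd0 _))
  simp_rw [hsummand]
  -- step 4
  apply recombine_eq_coeff hn0 _ _ hi
  refine (natDegree_sum_ofSeq_mul_X_pow_le hd0 _ _ _).trans_lt ?_
  have h4 : m * (2 ^ (k - q) - 1) = 2 ^ k - m := by rw [Nat.mul_sub_one, ← hn]
  rw [h4]
  omega

end Literature.Computability.AlgebraicComplexity
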